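import Literature.Probability.RandomPlanarGeometry.HexSAWPolygonStepTwoLeafSlide
import Literature.Probability.RandomPlanarGeometry.HexSAWPolygonStepTwoLeafCrown
import HarnessLib

/-!
# The step `2` for honeycomb polygon numbers: the FOUR-SLOT injection
# `#{X ∪ Y⋆ ∪ (leaf ∩ bottom-served) ∪ leaf-slide ∪ (leaf-crown ∩ bottom-leaf)} ≤ q_{N+2}(ℍ)`

Topic `Literature/Probability/RandomPlanarGeometry` (lane «pcv-sawmu», a-p4 g20; assembly of `HexSAWPolygonStepTwoTwoCorner.lean`
(the two-corner map: `exists_stepTwoRoof_image` / `exists_stepTwoBottom_image` with their decodings and the cross lemmas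
`not_isTopLeaf_of_roofDatum`, `isTopLeaf_of_bottomDatum`), `HexSAWPolygonStepTwoLeafSlide.lean` (the leaf slide: `IsLeafSlide`,
`SlideDatum`, `exists_leafSlide_image`, `eq_of_leafSlide_image_eq`, `not_isTopLeaf_spliceU`, `spliceU_ne_roof`) and
`HexSAWPolygonStepTwoLeafCrown.lean` (the leaf crown and the bottom-leaf class: `IsLeafCrown`, `IsBotLeaf`, `CrownDatum`,
`exists_leafCrown_image`, `eq_of_leafCrown_image_eq`, `isTopLeaf_spliceV`, `isBotLeaf_of_crownDatum`, `not_isBotLeaf_of_bottomDatum`)).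

The four kinds of images are pairwise distinct by two bits and one site: a top image is not top-leaf and carries a `RoofDatum`; a bottom
image is top-leaf and not bottom-leaf; a slide image is not top-leaf and carries no `RoofDatum`; a crown image is top-leaf and bottom-leaf.
★ **`card_filter_isStepTwoFourSlot_le : 5 ≤ n → #{ω ∈ canonEnd n | IsStepTwoFourSlot n ω} ≤ #canonEnd (n+2)`** with
`IsStepTwoFourSlot n ω := IsStepTwoTwoCorner n ω ∨ IsLeafSlide n ω ∨ (IsLeafCrown n ω ∧ IsBotLeaf n ω)`; the complement form and the
printed normalisation `q_{n+1}(ℍ) − #{leaf ∧ ¬bottom-served ∧ ¬slide ∧ ¬(crown ∧ bottom-leaf)} ≤ q_{n+3}(ℍ)`.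

NOT claimed: `q_N(ℍ) ≤ q_{N+2}(ℍ)`.  Numerically (`HOME/pub-sawmu-a-p4/g20/three/py/slideUV.py`, door note
`DOOR-STEP-TWO-THIRD-SLOT-g20.md`) the four-slot residue is exactly the class of polygons whose top-right hexagon is an up-right leaf on a
support run of length ONE («domino antenna») and whose bottom-right hexagon is a down-right leaf: `1, 0, 2, 1, 7, 11, 41, 93, 306, 790`
of `12, 18, 65, 138, 432, 1074, 3231, 8718, 25 999, 73 650` for `N = 14, …, 32` (≈ 1.1 %, down from ≈ 2.5 % for the two corners).
Label (lane): LANE LEMMA / infrastructure for an open combinatorial item; no literature claim beyond the transplanted `ℤ^d` method.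
-/

noncomputable section

open Finset Function Literature.Probability.LatticeModels Literature.Probability.Percolation SimpleGraph

namespace Literature.Probability.RandomPlanarGeometry.SAW

namespace HexBW

namespace PolygonConcat

variable {n : ℕ} {ω : ℕ → Site 2}

section FourSlot

/-- **The class served by the four slots**: the two-corner class, the leaf-slide class, or leaf-crown ∧ bottom-leaf.
[cite: MadrasSlade1993, §3.2 (proof of Theorem 3.2.3)] -/
def IsStepTwoFourSlot (n : ℕ) (ω : ℕ → Site 2) : Prop :=
  IsStepTwoTwoCorner n ω ∨ IsLeafSlide n ω ∨ (IsLeafCrown n ω ∧ IsBotLeaf n ω)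

/-- The four-slot class contains the three-slot class of `HexSAWPolygonStepTwoLeafSlide`. [cite: MadrasSlade1993, §3.2 (proof of Theorem 3.2.3)] -/
theorem isStepTwoFourSlot_of_isStepTwoThreeSlot (h : IsStepTwoThreeSlot n ω) : IsStepTwoFourSlot n ω := by
  rcases h with h | h
  · exact Or.inl h
  · exact Or.inr (Or.inl h)

/-- The four-slot class contains the crown-slot class of `HexSAWPolygonStepTwoLeafCrown`. [cite: MadrasSlade1993, §3.2 (proof of Theorem 3.2.3)] -/
theorem isStepTwoFourSlot_of_isStepTwoCrownSlot (h : IsStepTwoCrownSlot n ω) : IsStepTwoFourSlot n ω := by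
  rcases h with h | h
  · exact Or.inl h
  · exact Or.inr (Or.inr h)

/-- **★ The step two holds on the four-slot class**: the canonical rooted `(n+1)`-gons (`n ≥ 5`) of class
X ∪ Y⋆ ∪ (leaf ∩ bottom-served) ∪ leaf-slide ∪ (leaf-crown ∩ bottom-leaf) inject into the canonical rooted `(n+3)`-gons.
[cite: MadrasSlade1993, §3.2, Theorem 3.2.3 / (3.2.3) (the `ℤ^d` statement being transplanted)] -/
theorem card_filter_isStepTwoFourSlot_le [DecidablePred (IsStepTwoFourSlot n)] (hn : 5 ≤ n) :
    #((canonEnd n).filter (IsStepTwoFourSlot n)) ≤ #(canonEnd (n + 2)) := by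
  classical
  let P1 : (ℕ → Site 2) → Prop := fun ω => ω ∈ canonEnd n ∧ IsStepTwoRoof n ω
  let P2 : (ℕ → Site 2) → Prop := fun ω => ω ∈ canonEnd n ∧ IsTopLeaf n ω ∧ IsStepTwoBottom n ω
  let P3 : (ℕ → Site 2) → Prop := fun ω => ω ∈ canonEnd n ∧ IsLeafSlide n ω
  let P4 : (ℕ → Site 2) → Prop := fun ω => ω ∈ canonEnd n ∧ IsLeafCrown n ω ∧ IsBotLeaf n ω
  let E : (ℕ → Site 2) → (ℕ → Site 2) := fun ω =>
    if h : P1 ω then Classical.choose (exists_stepTwoRoof_image h.1 hn h.2)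
    else if h' : P2 ω then Classical.choose (exists_stepTwoBottom_image h'.1 hn h'.2.2)
    else if h'' : P3 ω then Classical.choose (exists_leafSlide_image h''.1 h''.2)
    else if h''' : P4 ω then Classical.choose (exists_leafCrown_image h'''.1 h'''.2.1)
    else ω
  have hE1 : ∀ ω (h : P1 ω), E ω = Classical.choose (exists_stepTwoRoof_image h.1 hn h.2) := fun ω h => dif_pos h
  have hE2 : ∀ ω, ¬ P1 ω → ∀ h' : P2 ω, E ω = Classical.choose (exists_stepTwoBottom_image h'.1 hn h'.2.2) := by
    intro ω h1 h'
    show (if h : P1 ω then _ else _) = _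
    rw [dif_neg h1, dif_pos h']
  have hE3 : ∀ ω, ¬ P1 ω → ¬ P2 ω → ∀ h'' : P3 ω, E ω = Classical.choose (exists_leafSlide_image h''.1 h''.2) := by
    intro ω h1 h2 h''
    show (if h : P1 ω then _ else _) = _
    rw [dif_neg h1, dif_neg h2, dif_pos h'']
  have hE4 : ∀ ω, ¬ P1 ω → ¬ P2 ω → ¬ P3 ω → ∀ h''' : P4 ω,
      E ω = Classical.choose (exists_leafCrown_image h'''.1 h'''.2.1) := by
    intro ω h1 h2 h3 h'''
    show (if h : P1 ω then _ else _) = _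
    rw [dif_neg h1, dif_neg h2, dif_neg h3, dif_pos h''']
  -- the four kinds of images
  have himgR : ∀ ω (h : P1 ω), E ω ∈ canonEnd (n + 2) ∧ ¬ IsTopLeaf (n + 2) (E ω) ∧
      ∃ (H xm : ℤ) (j k : ℕ) (fwd : Bool), (∀ i, i ≤ n → ω i 1 ≤ H) ∧ (∀ i, i ≤ n → ω i 1 = H → ω i 0 ≤ xm) ∧
        RoofDatum n ω (E ω) H xm j k fwd := by
    intro ω h
    rw [hE1 ω h]
    obtain ⟨hW, H, xm, j, k, fwd, hmaxH, hmaxX, hd⟩ := Classical.choose_spec (exists_stepTwoRoof_image h.1 hn h.2)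
    exact ⟨hW, not_isTopLeaf_of_roofDatum h.1 (by omega) hmaxH hmaxX hd, H, xm, j, k, fwd, hmaxH, hmaxX, hd⟩
  have himgB : ∀ ω, ¬ P1 ω → ∀ h' : P2 ω, E ω ∈ canonEnd (n + 2) ∧ IsTopLeaf (n + 2) (E ω) ∧ ¬ IsBotLeaf (n + 2) (E ω) ∧
      ∃ (L xb : ℤ) (j k : ℕ) (fwd : Bool), (∀ i, i ≤ n → L ≤ ω i 1) ∧ (∀ i, i ≤ n → ω i 1 = L → ω i 0 ≤ xb) ∧
        BottomDatum n ω (E ω) L xb j k fwd := by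
    intro ω h1 h'
    rw [hE2 ω h1 h']
    obtain ⟨hW, L, xb, j, k, fwd, hminH, hmaxX, hd⟩ :=
      Classical.choose_spec (exists_stepTwoBottom_image h'.1 hn h'.2.2)
    exact ⟨hW, isTopLeaf_of_bottomDatum h'.1 hd h'.2.1, not_isBotLeaf_of_bottomDatum h'.1 hminH hmaxX hd,
      L, xb, j, k, fwd, hminH, hmaxX, hd⟩
  have himgS : ∀ ω, ¬ P1 ω → ¬ P2 ω → ∀ h'' : P3 ω, E ω ∈ canonEnd (n + 2) ∧ ¬ IsTopLeaf (n + 2) (E ω) ∧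
      ∃ (H xm : ℤ) (j : ℕ) (fwd : Bool), (∀ i, i ≤ n → ω i 1 ≤ H) ∧ (∀ i, i ≤ n → ω i 1 = H → ω i 0 ≤ xm) ∧
        SlideDatum n ω (E ω) H xm j fwd := by
    intro ω h1 h2 h''
    rw [hE3 ω h1 h2 h'']
    obtain ⟨hW, H, xm, j, fwd, hmaxH, hmaxX, hd⟩ := Classical.choose_spec (exists_leafSlide_image h''.1 h''.2)
    refine ⟨hW, ?_, H, xm, j, fwd, hmaxH, hmaxX, hd⟩
    obtain ⟨hP, -, hWeq⟩ := hd
    rw [hWeq]; exact not_isTopLeaf_spliceU h''.1 hmaxH hmaxX hP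
  have himgC : ∀ ω, ¬ P1 ω → ¬ P2 ω → ¬ P3 ω → ∀ h''' : P4 ω,
      E ω ∈ canonEnd (n + 2) ∧ IsTopLeaf (n + 2) (E ω) ∧ IsBotLeaf (n + 2) (E ω) ∧
      ∃ (H xm : ℤ) (j : ℕ) (fwd : Bool), (∀ i, i ≤ n → ω i 1 ≤ H) ∧ (∀ i, i ≤ n → ω i 1 = H → ω i 0 ≤ xm) ∧
        CrownDatum n ω (E ω) H xm j fwd := by
    intro ω h1 h2 h3 h'''
    rw [hE4 ω h1 h2 h3 h''']
    obtain ⟨hW, H, xm, j, fwd, hmaxH, hmaxX, hdepth, hd⟩ := Classical.choose_spec (exists_leafCrown_image h'''.1 h'''.2.1)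
    refine ⟨hW, ?_, isBotLeaf_of_crownDatum hd hdepth h'''.2.2, H, xm, j, fwd, hmaxH, hmaxX, hd⟩
    obtain ⟨hx2, hP, -, hWeq⟩ := hd
    rw [hWeq]; exact isTopLeaf_spliceV hx2 hmaxH hmaxX hP
  have hbranch : ∀ ω, ω ∈ canonEnd n → IsStepTwoFourSlot n ω →
      P1 ω ∨ (¬ P1 ω ∧ P2 ω) ∨ (¬ P1 ω ∧ ¬ P2 ω ∧ P3 ω) ∨ (¬ P1 ω ∧ ¬ P2 ω ∧ ¬ P3 ω ∧ P4 ω) := by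
    intro ω hω hc
    by_cases h1 : P1 ω
    · exact Or.inl h1
    by_cases h2 : P2 ω
    · exact Or.inr (Or.inl ⟨h1, h2⟩)
    by_cases h3 : P3 ω
    · exact Or.inr (Or.inr (Or.inl ⟨h1, h2, h3⟩))
    refine Or.inr (Or.inr (Or.inr ⟨h1, h2, h3, hω, ?_⟩))
    rcases hc with (hR | ⟨hl, hb⟩) | hs | hc
    · exact absurd ⟨hω, hR⟩ h1
    · exact absurd ⟨hω, hl, hb⟩ h2
    · exact absurd ⟨hω, hs⟩ h3
    · exact hc
  refine Finset.card_le_card_of_injOn E (fun ω hω => ?_) (fun ω₁ hω₁ ω₂ hω₂ heq => ?_)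
  · rw [Finset.mem_coe, Finset.mem_filter] at hω
    rw [Finset.mem_coe]
    rcases hbranch ω hω.1 hω.2 with h1 | ⟨h1, h2⟩ | ⟨h1, h2, h3⟩ | ⟨h1, h2, h3, h4⟩
    · exact (himgR ω h1).1
    · exact (himgB ω h1 h2).1
    · exact (himgS ω h1 h2 h3).1
    · exact (himgC ω h1 h2 h3 h4).1
  · rw [Finset.mem_coe, Finset.mem_filter] at hω₁ hω₂
    rcases hbranch ω₁ hω₁.1 hω₁.2 with a1 | ⟨a1, a2⟩ | ⟨a1, a2, a3⟩ | ⟨a1, a2, a3, a4⟩ <;>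
      rcases hbranch ω₂ hω₂.1 hω₂.2 with b1 | ⟨b1, b2⟩ | ⟨b1, b2, b3⟩ | ⟨b1, b2, b3, b4⟩
    -- R / R
    · obtain ⟨-, -, H₁, xm₁, j₁, k₁, fwd₁, hmaxH₁, hmaxX₁, h₁⟩ := himgR ω₁ a1
      obtain ⟨-, -, H₂, xm₂, j₂, k₂, fwd₂, hmaxH₂, hmaxX₂, h₂⟩ := himgR ω₂ b1
      rw [heq] at h₁
      exact eq_of_stepTwoRoof_image_eq hω₁.1 hω₂.1 hmaxH₁ hmaxX₁ hmaxH₂ hmaxX₂ h₁ h₂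
    -- R / B
    · exfalso
      obtain ⟨-, hnl, -⟩ := himgR ω₁ a1
      obtain ⟨-, hl, -⟩ := himgB ω₂ b1 b2
      rw [heq] at hnl; exact hnl hl
    -- R / S
    · exfalso
      obtain ⟨-, -, H₁, xm₁, j₁, k₁, fwd₁, hmaxH₁, hmaxX₁, h₁⟩ := himgR ω₁ a1
      obtain ⟨-, -, H₂, xm₂, j₂, fwd₂, hmaxH₂, hmaxX₂, hP₂, -, hW₂⟩ := himgS ω₂ b1 b2 b3
      rw [heq, hW₂] at h₁
      exact spliceU_ne_roof hω₂.1 hω₁.1 (by omega) hmaxH₂ hmaxX₂ hmaxH₁ hmaxX₁ hP₂ h₁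
    -- R / C
    · exfalso
      obtain ⟨-, hnl, -⟩ := himgR ω₁ a1
      obtain ⟨-, hl, -⟩ := himgC ω₂ b1 b2 b3 b4
      rw [heq] at hnl; exact hnl hl
    -- B / R
    · exfalso
      obtain ⟨-, hnl, -⟩ := himgR ω₂ b1
      obtain ⟨-, hl, -⟩ := himgB ω₁ a1 a2
      rw [← heq] at hnl; exact hnl hl
    -- B / B
    · obtain ⟨-, -, -, L₁, xb₁, j₁, k₁, fwd₁, hminH₁, hmaxX₁, h₁⟩ := himgB ω₁ a1 a2
      obtain ⟨-, -, -, L₂, xb₂, j₂, k₂, fwd₂, hminH₂, hmaxX₂, h₂⟩ := himgB ω₂ b1 b2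
      rw [heq] at h₁
      exact eq_of_stepTwoBottom_image_eq hω₁.1 hω₂.1 hminH₁ hmaxX₁ hminH₂ hmaxX₂ h₁ h₂
    -- B / S
    · exfalso
      obtain ⟨-, hl, -⟩ := himgB ω₁ a1 a2
      obtain ⟨-, hnl, -⟩ := himgS ω₂ b1 b2 b3
      rw [heq] at hl; exact hnl hl
    -- B / C
    · exfalso
      obtain ⟨-, -, hnb, -⟩ := himgB ω₁ a1 a2
      obtain ⟨-, -, hbl, -⟩ := himgC ω₂ b1 b2 b3 b4
      rw [heq] at hnb; exact hnb hbl
    -- S / R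
    · exfalso
      obtain ⟨-, -, H₂, xm₂, j₂, k₂, fwd₂, hmaxH₂, hmaxX₂, h₂⟩ := himgR ω₂ b1
      obtain ⟨-, -, H₁, xm₁, j₁, fwd₁, hmaxH₁, hmaxX₁, hP₁, -, hW₁⟩ := himgS ω₁ a1 a2 a3
      rw [← heq, hW₁] at h₂
      exact spliceU_ne_roof hω₁.1 hω₂.1 (by omega) hmaxH₁ hmaxX₁ hmaxH₂ hmaxX₂ hP₁ h₂
    -- S / B
    · exfalso
      obtain ⟨-, hnl, -⟩ := himgS ω₁ a1 a2 a3
      obtain ⟨-, hl, -⟩ := himgB ω₂ b1 b2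
      rw [heq] at hnl; exact hnl hl
    -- S / S
    · obtain ⟨-, -, H₁, xm₁, j₁, fwd₁, hmaxH₁, hmaxX₁, h₁⟩ := himgS ω₁ a1 a2 a3
      obtain ⟨-, -, H₂, xm₂, j₂, fwd₂, hmaxH₂, hmaxX₂, h₂⟩ := himgS ω₂ b1 b2 b3
      rw [heq] at h₁
      exact eq_of_leafSlide_image_eq hω₁.1 hω₂.1 hmaxH₁ hmaxX₁ hmaxH₂ hmaxX₂ h₁ h₂
    -- S / C
    · exfalso
      obtain ⟨-, hnl, -⟩ := himgS ω₁ a1 a2 a3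
      obtain ⟨-, hl, -⟩ := himgC ω₂ b1 b2 b3 b4
      rw [heq] at hnl; exact hnl hl
    -- C / R
    · exfalso
      obtain ⟨-, hnl, -⟩ := himgR ω₂ b1
      obtain ⟨-, hl, -⟩ := himgC ω₁ a1 a2 a3 a4
      rw [← heq] at hnl; exact hnl hl
    -- C / B
    · exfalso
      obtain ⟨-, -, hbl, -⟩ := himgC ω₁ a1 a2 a3 a4
      obtain ⟨-, -, hnb, -⟩ := himgB ω₂ b1 b2
      rw [heq] at hbl; exact hnb hbl
    -- C / S
    · exfalso
      obtain ⟨-, hl, -⟩ := himgC ω₁ a1 a2 a3 a4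
      obtain ⟨-, hnl, -⟩ := himgS ω₂ b1 b2 b3
      rw [heq] at hl; exact hnl hl
    -- C / C
    · obtain ⟨-, -, -, H₁, xm₁, j₁, fwd₁, hmaxH₁, hmaxX₁, h₁⟩ := himgC ω₁ a1 a2 a3 a4
      obtain ⟨-, -, -, H₂, xm₂, j₂, fwd₂, hmaxH₂, hmaxX₂, h₂⟩ := himgC ω₂ b1 b2 b3 b4
      rw [heq] at h₁
      exact eq_of_leafCrown_image_eq hω₁.1 hω₂.1 hmaxH₁ hmaxX₁ hmaxH₂ hmaxX₂ h₁ h₂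

/-- **Complement form**: `#canonEnd n − #{four-slot residue} ≤ #canonEnd (n+2)`, the residue being the top-leaf polygons served
neither at the bottom corner, nor by the slide, nor by the crown. [cite: MadrasSlade1993, §3.2, Theorem 3.2.3 / (3.2.3)] -/
theorem card_canonEnd_sub_card_filter_fourSlotResidue_le [DecidablePred (IsStepTwoFourSlot n)]
    [DecidablePred fun ω => IsTopLeaf n ω ∧ ¬ IsStepTwoBottom n ω ∧ ¬ IsLeafSlide n ω ∧ ¬ (IsLeafCrown n ω ∧ IsBotLeaf n ω)]
    (hn : 5 ≤ n) :
    #(canonEnd n) - #((canonEnd n).filter fun ω =>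
        IsTopLeaf n ω ∧ ¬ IsStepTwoBottom n ω ∧ ¬ IsLeafSlide n ω ∧ ¬ (IsLeafCrown n ω ∧ IsBotLeaf n ω)) ≤
      #(canonEnd (n + 2)) := by
  classical
  have hcover : canonEnd n ⊆ (canonEnd n).filter (IsStepTwoFourSlot n) ∪
      (canonEnd n).filter (fun ω =>
        IsTopLeaf n ω ∧ ¬ IsStepTwoBottom n ω ∧ ¬ IsLeafSlide n ω ∧ ¬ (IsLeafCrown n ω ∧ IsBotLeaf n ω)) := by
    intro ω hω
    rcases isStepTwoRoof_or_isTopLeaf hω hn with h | h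
    · exact Finset.mem_union_left _ (Finset.mem_filter.2 ⟨hω, Or.inl (Or.inl h)⟩)
    · by_cases hb : IsStepTwoBottom n ω
      · exact Finset.mem_union_left _ (Finset.mem_filter.2 ⟨hω, Or.inl (Or.inr ⟨h, hb⟩)⟩)
      · by_cases hs : IsLeafSlide n ω
        · exact Finset.mem_union_left _ (Finset.mem_filter.2 ⟨hω, Or.inr (Or.inl hs)⟩)
        · by_cases hc : IsLeafCrown n ω ∧ IsBotLeaf n ω
          · exact Finset.mem_union_left _ (Finset.mem_filter.2 ⟨hω, Or.inr (Or.inr hc)⟩)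
          · exact Finset.mem_union_right _ (Finset.mem_filter.2 ⟨hω, h, hb, hs, hc⟩)
  have h1 := (Finset.card_le_card hcover).trans (Finset.card_union_le _ _)
  have h2 := card_filter_isStepTwoFourSlot_le (n := n) hn
  omega

/-- **Printed normalisation**: `q_{n+1}(ℍ) − #{four-slot residue} ≤ q_{n+3}(ℍ)` (`n ≥ 5`).
[cite: MadrasSlade1993, §3.2, Theorem 3.2.3 / (3.2.3)] -/
theorem hexPolygonNumber_sub_card_fourSlotResidue_le
    [DecidablePred fun ω => IsTopLeaf n ω ∧ ¬ IsStepTwoBottom n ω ∧ ¬ IsLeafSlide n ω ∧ ¬ (IsLeafCrown n ω ∧ IsBotLeaf n ω)]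
    (hn : 5 ≤ n) :
    hexPolygonNumber (n + 1) - #((canonEnd n).filter fun ω =>
        IsTopLeaf n ω ∧ ¬ IsStepTwoBottom n ω ∧ ¬ IsLeafSlide n ω ∧ ¬ (IsLeafCrown n ω ∧ IsBotLeaf n ω)) ≤
      hexPolygonNumber (n + 3) := by
  classical
  have h := card_canonEnd_sub_card_filter_fourSlotResidue_le (n := n) hn
  rw [card_canonEnd (by omega), card_canonEnd (by omega)] at h
  exact h

/-- The four-slot class contains the two-corner class (hence the classes of the roof and main files).
[cite: MadrasSlade1993, §3.2 (proof of Theorem 3.2.3)] -/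
theorem card_filter_isStepTwoTwoCorner_le_card_filter_isStepTwoFourSlot [DecidablePred (IsStepTwoTwoCorner n)]
    [DecidablePred (IsStepTwoFourSlot n)] :
    #((canonEnd n).filter (IsStepTwoTwoCorner n)) ≤ #((canonEnd n).filter (IsStepTwoFourSlot n)) :=
  Finset.card_le_card fun ω hω => by
    rw [Finset.mem_filter] at hω ⊢
    exact ⟨hω.1, Or.inl hω.2⟩

end FourSlot

end PolygonConcat

end HexBW

end Literature.Probability.RandomPlanarGeometry.SAW

end
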